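import Summits.NavierStokesRegularity.FluidComputer.GateBudgetColdAction
import HarnessLib

/-!
# What no tuning can beat, part 59: THE TWO UPPER RELIGHT LAWS — after a dousing at clock `-θε`
# with output pair `P₀` and a trigger floor `(ρ²/K⁹)e^{-L} ≤ c(T)`, a window `[T, u]` on which
# the trigger of a headline member stays `≤ ρ²/K⁹` is SHORT on both counts: the DEBT law
# `u ≤ T + 2θ/s_l + L/(K¹⁰θ)` (the clock action repays the dousing debt and the trigger's memory
# relights it) and the SEED law `s_l(u - tz)²/2 < 1` about the clock zero `tz` (the fresh
# production `σa²` near `tz`, amplified by `e^{K¹⁰s_l(u - tz)²/2}`, relights it) — the upper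
# half of law 4″ of the θ-drift audit (`s_l = 1 - P₀ - 8/K⁹`, `s_u = 1 - P₀ + 6/K⁹`)

Cell `pub-fluidc`, blueprint seat bp1 (gen 35, second item); same namespace and conventions as
parts 1–58 (`GateBudget*.lean`); imports part 58 (`GateBudgetColdAction`: §174–§179, hence
part 57 §172 `knob_cold_brackets` and part 56 `knob_trigger_memory`, `exists_clock_action`,
`hasDerivAt_c`, `c_nonneg`). Headline knob family `rotorCircuit K K¹⁰ ε ρ` (`σ = ρ²e^{-K¹⁰}`,
`μ = ε⁻¹K¹⁰`; modes `0 = a` carrier, `1 = b` clock, `2 = c` trigger, `3 = d`, `4 = ã`). HONEST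
FRAMING (verbatim): low prior, high value-of-information experiment on Tao's machine paradigm;
NOT a claim that NS blows up. Nothing is proved about the Navier–Stokes equations.

## Why (SPEC-INPUT-bp1 §AZ/§BA/§BB: the θ-ledger needs the relight clock two-sidedly)

The misfire ladder iterates "dousing at clock `-θₙε` → cold phase → relight at clock `θₙ₊₁ε`",
and the relight clock is `θₙ₊₁ε = b(r) ∈ ε[s_l, s_u](r - tz)` (part 58 §177), so the ledger
needs the relight time `r` two-sidedly about the clock zero `tz`. Part 58 supplies the LOWER
half (no relight before `tz`, nor after it while the debt `B ≤ B(T)` is unpaid and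
`s_u(t - tz)²/2 ≤ 1 - 10 log K/K¹⁰`). This file supplies the two UPPER halves:
* DEBT (§181): by part 56's memory law `c(u) ≥ c(T)e^{μ(B(u) - B(T))}` and part 58 §176's
  lower parabola `B(u) - B(T) ≥ ε(u - T)(s_l(u - T)/2 - θ)`, once
  `(u - T)(s_l(u - T)/2 - θ) > L/K¹⁰` the trigger exceeds `(ρ²/K⁹)e^{-L}e^{L} = ρ²/K⁹`; and
  `(u - T)(s_l(u - T)/2 - θ) - L/K¹⁰` is a sum of non-negative terms plus a positive one as
  soon as `u - T > 2θ/s_l + L/(K¹⁰θ)` (an exact identity, no square roots).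
* SEED (§182): with `w = K⁻⁵` (`K¹⁰w² = 1`), on `[tz - w, tz + w]` the discounted trigger
  `g = c·e^{-μ(B - B(tz))}` has `g' = σa²e^{-μ(B - B(tz))} ≥ σs_l e^{-s_u/2}` (carrier
  `a² ≥ s_l`, action `B - B(tz) ≤ εs_u w²/2`), so `g(tz + w) ≥ 2wσs_l e^{-s_u/2}` (§182a, a
  brick over `fiveGateCircuit`); memory then gives
  `c(u) ≥ 2wσs_l e^{-s_u/2}e^{μ(B(u) - B(tz))} ≥ 2wσs_l e^{-s_u/2}e^{K¹⁰s_l(u - tz)²/2}`, and if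
  `s_l(u - tz)²/2 ≥ 1` the last factor beats `e^{K¹⁰}`: `c(u) ≥ 2K⁻⁵ρ²s_l e^{-s_u/2} ≥
  2K⁻⁵ρ²s_l/3 > ρ²/K⁹` (`2K⁴s_l > 3`), contradicting the window.
The assembled law 4″ (existence of `tz` and `r`, `c(r) = ρ²/K⁹`, both bounds, the clock at
`r`) is part 60 (`GateBudgetRelightLaw`).

## What is proved (every constant carried as `c/K⁹` or `L/(K¹⁰θ)`, nothing rounded)

* §180 `relight_numerics` — `2ρ²/K¹⁰ + 3σ < ρ²/K⁹`, `2ρ²/K¹⁰ + 3ρ²/K¹⁰ < ρ²/K⁹`,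
  `K⁻⁵ ≤ 2⁻²⁰` and `K⁴ ≥ 65536` for `K ≥ 16`.
* §181 `knob_cold_debt_relight` — under part 57 §172's window hypotheses (`c ≤ ρ²/K⁹` on
  `[T, u]`, `u ≤ T + 3`, `b(T) = -θε`, `P₀ = d(T)² + ã(T)²`) with `0 < θ ≤ 3/2`, `P₀ ≤ 1/2` and
  a floor `(ρ²/K⁹)e^{-L} ≤ c(T)`, `L ≥ 0`: `u ≤ T + 2θ/s_l + L/(K¹⁰θ)`.
* §182a `seed_production` — the brick: `σs e^{-E}·2w ≤ c(tz + w)e^{-μ(B(tz + w) - B(tz))}` if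
  `a² ≥ s` and `μ(B - B(tz)) ≤ E` on `[tz - w, tz + w]`, `tz ≥ w`.
* §182 `knob_cold_seed` — same window with `P₀ ≤ 1/2` and the clock zero `tz ∈ [T + K⁻⁵, u]`:
  `s_l(u - tz)²/2 < 1`.
-/

noncomputable section

namespace Summit.NavierStokesRegularity.FluidComputer.GateBudget

open Real Set
open Literature.Analysis.FluidPDE.Tao2016AveragedNS

variable {K ε ρ : ℝ} {X : ℝ → Fin 5 → ℝ}

/-! ## §180 Numerics of the relight law -/

/-- §180 NUMERICS: for `K ≥ 16`, `2ρ²/K¹⁰ + 3ρ²e^{-K¹⁰} < ρ²/K⁹`, `2ρ²/K¹⁰ + 3ρ²/K¹⁰ < ρ²/K⁹`,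
`K⁻⁵ ≤ 2⁻²⁰` and `K⁴ ≥ 65536`. [derived: this file §180] -/
theorem relight_numerics (hK : 16 ≤ K) (hρ : 0 < ρ) :
    2 * ρ ^ 2 / K ^ 10 + 3 * (ρ ^ 2 * exp (-K ^ 10)) < ρ ^ 2 / K ^ 9 ∧
      2 * ρ ^ 2 / K ^ 10 + 3 * ρ ^ 2 / K ^ 10 < ρ ^ 2 / K ^ 9 ∧
      (K ^ 5)⁻¹ ≤ (1 : ℝ) / 1048576 ∧ (65536 : ℝ) ≤ K ^ 4 := by
  have hK0 : (0 : ℝ) < K := by linarith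
  have hK9 : (0 : ℝ) < K ^ 9 := by positivity
  have hK10 : (0 : ℝ) < K ^ 10 := by positivity
  have h4 : (16 : ℝ) ^ 4 ≤ K ^ 4 := pow_le_pow_left₀ (by norm_num) hK 4
  have h5 : (16 : ℝ) ^ 5 ≤ K ^ 5 := pow_le_pow_left₀ (by norm_num) hK 5
  have hexp : exp (-K ^ 10) ≤ 1 / K ^ 10 := by
    rw [Real.exp_neg, ← one_div]
    exact one_div_le_one_div_of_le hK10 (by linarith [Real.add_one_le_exp (K ^ 10)])
  have hq : 5 * ρ ^ 2 / K ^ 10 < ρ ^ 2 / K ^ 9 := by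
    rw [div_lt_div_iff₀ hK10 hK9]
    have h1 : 5 * K ^ 9 < K ^ 10 := by nlinarith [hK9]
    nlinarith [h1, pow_pos hρ 2]
  have e5 : 2 * ρ ^ 2 / K ^ 10 + 3 * ρ ^ 2 / K ^ 10 = 5 * ρ ^ 2 / K ^ 10 := by ring
  have h3 := mul_le_mul_of_nonneg_left hexp (by positivity : (0 : ℝ) ≤ 3 * ρ ^ 2)
  have e0 : 3 * (ρ ^ 2 * exp (-K ^ 10)) = 3 * ρ ^ 2 * exp (-K ^ 10) := by ring
  have e1 : 3 * ρ ^ 2 * (1 / K ^ 10) = 3 * ρ ^ 2 / K ^ 10 := by ring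
  refine ⟨by linarith, by linarith, ?_, by norm_num at h4; exact h4⟩
  rw [← one_div]
  exact one_div_le_one_div_of_le (by norm_num) (by norm_num at h5; exact h5)

/-! ## §181 The debt law: an UPPER bound on the relight time from the trigger's memory -/

/-- §181 THE DEBT IS REPAID BY `T + 2θ/s_l + L/(K¹⁰θ)`: under part 57 §172's hypotheses with
`θ > 0`, `P₀ ≤ 1/2` and a trigger floor `(ρ²/K⁹)e^{-L} ≤ c(T)`, a window `[T, u]` on which
`c ≤ ρ²/K⁹` has `u ≤ T + 2θ/s_l + L/(K¹⁰θ)`: beyond that time part 58 §176's lower parabola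
gives `μ(B(u) - B(T)) > L`, and part 56's memory law `c(u) ≥ c(T)e^{μ(B(u) - B(T))} > ρ²/K⁹`.
[derived: this file §181] -/
theorem knob_cold_debt_relight
    (hX : ∀ t, HasDerivAt X (RotorKnob.rotorCircuit K (K ^ 10) ε ρ (X t)) t)
    (h0 : X 0 = delayInit) (hK : 16 ≤ K) (hε : 0 < ε) (hεK : ε ^ 2 ≤ 1 / (6 * K ^ 20))
    (hρ : 0 < ρ) (hhi : K ^ 10 * ρ ^ 2 ≤ 2 * ε) {T u θ P₀ : ℝ} (hT : 0 ≤ T)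
    (hu : u ≤ T + 3) (hθ : 0 < θ) (hθ2 : θ ≤ 3 / 2) (hbT : X T 1 = -(θ * ε))
    (hP : X T 3 ^ 2 + X T 4 ^ 2 = P₀) (hc : ∀ t ∈ Icc T u, X t 2 ≤ ρ ^ 2 / K ^ 9)
    (hP0 : P₀ ≤ 1 / 2) {L : ℝ} (hL : 0 ≤ L) (hℓ : ρ ^ 2 / K ^ 9 * exp (-L) ≤ X T 2) :
    u ≤ T + 2 * θ / (1 - P₀ - 8 / K ^ 9) + L / (K ^ 10 * θ) := by
  have hK0 : (0 : ℝ) < K := by linarith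
  have hK10 : (0 : ℝ) < K ^ 10 := by positivity
  have hsl := (cold_slopes hK hP0).2.2.2
  obtain ⟨sl, hsl_def⟩ : ∃ sl : ℝ, sl = 1 - P₀ - 8 / K ^ 9 := ⟨_, rfl⟩
  rw [← hsl_def] at hsl ⊢
  have hsl0 : sl ≠ 0 := hsl.ne'
  have hθ0 : θ ≠ 0 := hθ.ne'
  have hK0' : K ≠ 0 := hK0.ne'
  have hε0 : ε ≠ 0 := hε.ne'
  by_contra hlt
  have hlt := not_le.1 hlt
  have hD0 : 0 ≤ 2 * θ / sl + L / (K ^ 10 * θ) := by positivity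
  have hTu : T ≤ u := by linarith
  have huI : u ∈ Icc T u := right_mem_Icc.2 hTu
  have hXf := hX
  rw [RotorKnob.rotorCircuit_eq_fiveGate] at hXf
  obtain ⟨B, hB⟩ := exists_clock_action hXf
  have hact := (knob_cold_action hX h0 hK hε hεK hρ hhi hT hu hθ.le hθ2 hbT hP hc hB huI).1
  simp only [← hsl_def] at hact
  -- the debt is over-repaid: `(u - T)(s_l(u - T)/2 - θ) > L/K¹⁰`
  obtain ⟨A, hA_def⟩ : ∃ A : ℝ, A = sl * L / (2 * K ^ 10 * θ) := ⟨_, rfl⟩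
  have hA : 0 ≤ A := by rw [hA_def]; positivity
  have hτ : 0 < u - T - (2 * θ / sl + L / (K ^ 10 * θ)) := by linarith
  have hx : 0 < u - T := by linarith
  have eI : (u - T) * (sl * (u - T) / 2 - θ) - L / K ^ 10
      = (u - T - (2 * θ / sl + L / (K ^ 10 * θ))) * A + L / (K ^ 10 * θ) * A
        + (u - T) * sl * (u - T - (2 * θ / sl + L / (K ^ 10 * θ))) / 2 := by
    rw [hA_def]; field_simp; ring
  have hkey : L / K ^ 10 < (u - T) * (sl * (u - T) / 2 - θ) := by
    have h1 := mul_nonneg hτ.le hA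
    have h2 : 0 ≤ L / (K ^ 10 * θ) * A := by positivity
    have h3 : 0 < (u - T) * sl * (u - T - (2 * θ / sl + L / (K ^ 10 * θ))) / 2 := by
      have := mul_pos (mul_pos hx hsl) hτ; linarith
    linarith [eI, h1, h2, h3]
  have hμL : L < ε⁻¹ * K ^ 10 * (B u - B T) := by
    have h1 : ε * (L / K ^ 10) < B u - B T :=
      lt_of_lt_of_le (mul_lt_mul_of_pos_left hkey hε) hact
    have h2 := mul_lt_mul_of_pos_left h1 (by positivity : (0 : ℝ) < ε⁻¹ * K ^ 10)
    have e : ε⁻¹ * K ^ 10 * (ε * (L / K ^ 10)) = L := by field_simp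
    linarith [h2, e]
  have hcT : 0 < X T 2 := lt_of_lt_of_le (by positivity) hℓ
  have hmem := knob_trigger_memory hX h0 hε hK10.le hB hT hTu hcT
  have h1 : ρ ^ 2 / K ^ 9 * exp (-L) * exp L = ρ ^ 2 / K ^ 9 := by
    rw [mul_assoc, ← Real.exp_add, neg_add_cancel, Real.exp_zero, mul_one]
  have h3 : ρ ^ 2 / K ^ 9 < X u 2 :=
    calc ρ ^ 2 / K ^ 9 = ρ ^ 2 / K ^ 9 * exp (-L) * exp L := h1.symm
      _ < ρ ^ 2 / K ^ 9 * exp (-L) * exp (ε⁻¹ * K ^ 10 * (B u - B T)) :=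
          mul_lt_mul_of_pos_left (Real.exp_lt_exp.2 hμL) (by positivity)
      _ ≤ X T 2 * exp (ε⁻¹ * K ^ 10 * (B u - B T)) :=
          mul_le_mul_of_nonneg_right hℓ (exp_pos _).le
      _ ≤ X u 2 := hmem
  exact absurd (hc u huI) (not_le.2 h3)

/-! ## §182 The seed law: an UPPER bound on the relight time from the fresh production -/

/-- §182a THE SEED'S FIRST PRODUCTION STEP (a brick over `fiveGateCircuit`, `σ, μ ≥ 0`): if on
`[tz - w, tz + w]` (`tz - w ≥ 0`) the carrier has `a² ≥ s` and the discounted action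
`μ(B - B(tz)) ≤ E`, then `g = c·e^{-μ(B - B(tz))}`, whose derivative is `σa²e^{-μ(B - B(tz))}
≥ σs e^{-E}`, gains at least `2wσs e^{-E}` across the interval, and `g(tz - w) ≥ 0`.
[derived: this file §182a] -/
theorem seed_production {σ μ R : ℝ}
    (hX : ∀ t, HasDerivAt X (fiveGateCircuit ε σ μ R K (X t)) t) (h0 : X 0 = delayInit)
    (hσ : 0 ≤ σ) {B : ℝ → ℝ} (hB : ∀ t, HasDerivAt B (X t 1) t) {tz w s E : ℝ}
    (hw : 0 < w) (htw : 0 ≤ tz - w) (ha : ∀ r ∈ Icc (tz - w) (tz + w), s ≤ X r 0 ^ 2)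
    (hE : ∀ r ∈ Icc (tz - w) (tz + w), μ * (B r - B tz) ≤ E) :
    σ * s * exp (-E) * (2 * w) ≤ X (tz + w) 2 * exp (-(μ * (B (tz + w) - B tz))) := by
  have hv : ∀ r, HasDerivAt (fun r => -(μ * (B r - B tz))) (-(μ * X r 1)) r := fun r =>
    (((hB r).sub_const (B tz)).const_mul μ).neg
  have hg : ∀ r, HasDerivAt (fun r => X r 2 * exp (-(μ * (B r - B tz))))
      (σ * X r 0 ^ 2 * exp (-(μ * (B r - B tz)))) r :=
    fun r => ((hasDerivAt_c hX r).mul (hv r).exp).congr_deriv (by ring)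
  have hgrow : ∀ r ∈ interior (Icc (tz - w) (tz + w)),
      σ * s * exp (-E) ≤ deriv (fun r => X r 2 * exp (-(μ * (B r - B tz)))) r := by
    intro r hr
    have hr' := interior_subset hr
    rw [(hg r).deriv]
    exact mul_le_mul (mul_le_mul_of_nonneg_left (ha r hr') hσ)
      (Real.exp_le_exp.2 (neg_le_neg (hE r hr'))) (exp_pos _).le (by positivity)
  have hdiff : Differentiable ℝ fun r => X r 2 * exp (-(μ * (B r - B tz))) :=
    fun r => (hg r).differentiableAt
  have hmvt := (convex_Icc (tz - w) (tz + w)).mul_sub_le_image_sub_of_le_deriv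
    hdiff.continuous.continuousOn hdiff.differentiableOn hgrow (tz - w)
    (left_mem_Icc.2 (by linarith)) (tz + w) (right_mem_Icc.2 (by linarith)) (by linarith)
  have hg0 : 0 ≤ X (tz - w) 2 * exp (-(μ * (B (tz - w) - B tz))) :=
    mul_nonneg (c_nonneg hX h0 hσ htw) (exp_pos _).le
  have e : tz + w - (tz - w) = 2 * w := by ring
  rw [e] at hmvt
  linarith

/-- §182 THE SEED RELIGHTS BEFORE `s_l(u - tz)²/2` REACHES `1`: under part 57 §172's hypotheses
with `P₀ ≤ 1/2` and the clock zero `tz ∈ [T + K⁻⁵, u]`, a window `[T, u]` on which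
`c ≤ ρ²/K⁹` has `s_l(u - tz)²/2 < 1`: otherwise `u ≥ tz + K⁻⁵`, §182a on
`[tz - K⁻⁵, tz + K⁻⁵]` (`a² ≥ s_l`, `μ(B - B(tz)) ≤ s_u/2` since `K¹⁰(K⁻⁵)² = 1`) gives
`c(tz + K⁻⁵)e^{-μ(B(tz + K⁻⁵) - B(tz))} ≥ 2K⁻⁵σs_l e^{-s_u/2}`, and part 56's memory law
carries it to `c(u) ≥ 2K⁻⁵σs_l e^{-s_u/2}e^{K¹⁰s_l(u - tz)²/2} ≥ 2K⁻⁵ρ²s_l e^{-s_u/2} > ρ²/K⁹`.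
[derived: this file §182] -/
theorem knob_cold_seed
    (hX : ∀ t, HasDerivAt X (RotorKnob.rotorCircuit K (K ^ 10) ε ρ (X t)) t)
    (h0 : X 0 = delayInit) (hK : 16 ≤ K) (hε : 0 < ε) (hεK : ε ^ 2 ≤ 1 / (6 * K ^ 20))
    (hρ : 0 < ρ) (hhi : K ^ 10 * ρ ^ 2 ≤ 2 * ε) {T u θ P₀ : ℝ} (hT : 0 ≤ T)
    (hu : u ≤ T + 3) (hθ : 0 ≤ θ) (hθ2 : θ ≤ 3 / 2) (hbT : X T 1 = -(θ * ε))
    (hP : X T 3 ^ 2 + X T 4 ^ 2 = P₀) (hc : ∀ t ∈ Icc T u, X t 2 ≤ ρ ^ 2 / K ^ 9)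
    (hP0 : P₀ ≤ 1 / 2) {B : ℝ → ℝ} (hB : ∀ t, HasDerivAt B (X t 1) t) {tz : ℝ}
    (htz : tz ∈ Icc T u) (hz : X tz 1 = 0) (hw : T + (K ^ 5)⁻¹ ≤ tz) :
    (1 - P₀ - 8 / K ^ 9) * (u - tz) ^ 2 / 2 < 1 := by
  have hK0 : (0 : ℝ) < K := by linarith
  have hK10 : (0 : ℝ) < K ^ 10 := by positivity
  have hε0 : ε ≠ 0 := hε.ne'
  obtain ⟨h8, h60, h6, hsl⟩ := cold_slopes hK hP0
  obtain ⟨-, -, hw5, h4⟩ := relight_numerics hK hρ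
  have hP00 : 0 ≤ P₀ := by rw [← hP]; positivity
  have h9 : (0 : ℝ) ≤ 1 / K ^ 9 := by positivity
  have h89 : (0 : ℝ) ≤ 8 / K ^ 9 := by positivity
  obtain ⟨sl, hsl_def⟩ : ∃ sl : ℝ, sl = 1 - P₀ - 8 / K ^ 9 := ⟨_, rfl⟩
  obtain ⟨su, hsu_def⟩ : ∃ su : ℝ, su = 1 - P₀ + 6 / K ^ 9 := ⟨_, rfl⟩
  obtain ⟨w, hw_def⟩ : ∃ w : ℝ, w = (K ^ 5)⁻¹ := ⟨_, rfl⟩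
  rw [← hsl_def] at hsl
  rw [← hw_def] at hw hw5
  have hw0 : 0 < w := by rw [hw_def]; positivity
  have hsl4 : 1 / 4 ≤ sl := by rw [hsl_def]; linarith only [hP0, h8]
  have hsl1 : sl ≤ 1 := by rw [hsl_def]; linarith only [hP00, h89]
  have hsu0 : 0 ≤ su := by rw [hsu_def]; linarith only [hP0, h60]
  have hsu1 : su ≤ 10001 / 10000 := by rw [hsu_def]; linarith only [hP00, h6]
  have hnum : 1 < 2 * K ^ 4 * sl / 3 := by nlinarith only [h4, hsl4]
  have hKw : K ^ 10 * w ^ 2 = 1 := by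
    rw [hw_def, inv_pow, ← pow_mul]; exact mul_inv_cancel₀ (by positivity)
  rw [← hsl_def]
  by_contra hge
  have hge := not_lt.1 hge
  -- then `u ≥ tz + 1 ≥ tz + w`
  have hutz : tz + w ≤ u := by
    have h1 : 2 ≤ (u - tz) ^ 2 := by nlinarith only [hge, hsl1, sq_nonneg (u - tz)]
    have h2 : 1 ≤ u - tz := by nlinarith only [h1, htz.2]
    linarith only [h2, hw5]
  have hza := fun r (hr : r ∈ Icc T u) =>
    (knob_cold_zero_action hX h0 hK hε hεK hρ hhi hT hu hθ hθ2 hbT hP hc hP0 hB htz hz hr).1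
  have hcar := fun r (hr : r ∈ Icc T u) =>
    (knob_cold_brackets hX h0 hK hε hεK hρ hhi hT hu hθ hθ2 hbT hP hc hr).2.1.1
  simp only [← hsl_def, ← hsu_def] at hza
  have hXf := hX
  rw [RotorKnob.rotorCircuit_eq_fiveGate] at hXf
  have hσ : 0 < ρ ^ 2 * exp (-K ^ 10) := by positivity
  have hμ : (0 : ℝ) ≤ ε⁻¹ * K ^ 10 := by positivity
  have hI : ∀ r ∈ Icc (tz - w) (tz + w), r ∈ Icc T u := fun r hr =>
    ⟨by linarith only [hr.1, hw], by linarith only [hr.2, hutz]⟩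
  -- on `[tz - w, tz + w]`: `a² ≥ s_l` and `μ(B - B(tz)) ≤ μεs_u w²/2 = s_u/2`
  have ha : ∀ r ∈ Icc (tz - w) (tz + w), sl ≤ X r 0 ^ 2 := fun r hr => by
    have h := hcar r (hI r hr)
    have e : (8 : ℝ) / K ^ 9 = 7 / K ^ 9 + 1 / K ^ 9 := by ring
    rw [hsl_def]; linarith only [h, e, h9]
  have hE : ∀ r ∈ Icc (tz - w) (tz + w), ε⁻¹ * K ^ 10 * (B r - B tz) ≤ su / 2 := by
    intro r hr
    have hsq : (r - tz) ^ 2 ≤ w ^ 2 :=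
      sq_le_sq' (by linarith only [hr.1]) (by linarith only [hr.2])
    have h0' : B r - B tz ≤ ε * su * w ^ 2 / 2 := by
      have := mul_le_mul_of_nonneg_left hsq (mul_nonneg hε.le hsu0)
      linarith only [(hza r (hI r hr)).2, this]
    have h1 := mul_le_mul_of_nonneg_left h0' hμ
    have e : ε⁻¹ * K ^ 10 * (ε * su * w ^ 2 / 2) = su / 2 * (K ^ 10 * w ^ 2) := by
      field_simp
    rw [hKw, mul_one] at e
    linarith only [h1, e]
  have hg1 := seed_production hXf h0 hσ.le hB hw0 (by linarith only [htz.1, hw, hT, hw0]) ha hE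
  have hC : 0 < ρ ^ 2 * exp (-K ^ 10) * sl * exp (-(su / 2)) * (2 * w) := by positivity
  have hc1 : 0 < X (tz + w) 2 := (mul_pos_iff_of_pos_right (exp_pos _)).1 (hC.trans_le hg1)
  -- memory from `tz + w` to `u`, where `e^{μ(B(u) - B(tz))} ≥ e^{K¹⁰s_l(u - tz)²/2} ≥ e^{K¹⁰}`
  have hmem := knob_trigger_memory hX h0 hε hK10.le hB (by linarith only [htz.1, hw, hT, hw0])
    hutz hc1
  have hsplit : X (tz + w) 2 * exp (ε⁻¹ * K ^ 10 * (B u - B (tz + w)))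
      = X (tz + w) 2 * exp (-(ε⁻¹ * K ^ 10 * (B (tz + w) - B tz)))
        * exp (ε⁻¹ * K ^ 10 * (B u - B tz)) := by
    rw [mul_assoc (X (tz + w) 2), ← Real.exp_add]; congr 2; ring
  have huI : u ∈ Icc T u := right_mem_Icc.2 (htz.1.trans htz.2)
  have hexpu : exp (K ^ 10) ≤ exp (ε⁻¹ * K ^ 10 * (B u - B tz)) := by
    refine Real.exp_le_exp.2 ?_
    have h1 := mul_le_mul_of_nonneg_left (hza u huI).1 hμ
    have e : ε⁻¹ * K ^ 10 * (ε * sl * (u - tz) ^ 2 / 2) = K ^ 10 * (sl * (u - tz) ^ 2 / 2) := by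
      field_simp
    have h2 : K ^ 10 * 1 ≤ K ^ 10 * (sl * (u - tz) ^ 2 / 2) :=
      mul_le_mul_of_nonneg_left hge hK10.le
    linarith only [h1, e, h2]
  have hlow : ρ ^ 2 * exp (-K ^ 10) * sl * exp (-(su / 2)) * (2 * w) * exp (K ^ 10) ≤ X u 2 :=
    calc ρ ^ 2 * exp (-K ^ 10) * sl * exp (-(su / 2)) * (2 * w) * exp (K ^ 10)
        ≤ X (tz + w) 2 * exp (-(ε⁻¹ * K ^ 10 * (B (tz + w) - B tz)))
            * exp (ε⁻¹ * K ^ 10 * (B u - B tz)) :=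
          mul_le_mul hg1 hexpu (exp_pos _).le (mul_nonneg hc1.le (exp_pos _).le)
      _ = X (tz + w) 2 * exp (ε⁻¹ * K ^ 10 * (B u - B (tz + w))) := hsplit.symm
      _ ≤ X u 2 := hmem
  -- numerics: `2K⁻⁵ρ²s_l e^{-s_u/2} ≥ 2K⁻⁵ρ²s_l/3 > ρ²/K⁹ ≥ c(u)`
  have hee : exp (-K ^ 10) * exp (K ^ 10) = 1 := by
    rw [← Real.exp_add, neg_add_cancel, Real.exp_zero]
  have hesu : (1 : ℝ) / 3 ≤ exp (-(su / 2)) := by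
    linarith only [Real.add_one_le_exp (-(su / 2)), hsu1]
  have hnum2 : ρ ^ 2 / K ^ 9 < ρ ^ 2 * sl * (1 / 3) * (2 * w) := by
    have e : ρ ^ 2 * sl * (1 / 3) * (2 * w) = ρ ^ 2 / K ^ 9 * (2 * K ^ 4 * sl / 3) := by
      rw [hw_def]; field_simp
    rw [e]
    exact lt_mul_of_one_lt_right (by positivity) hnum
  have h1 : ρ ^ 2 * sl * (1 / 3) * (2 * w) ≤ ρ ^ 2 * sl * exp (-(su / 2)) * (2 * w) :=
    mul_le_mul_of_nonneg_right (mul_le_mul_of_nonneg_left hesu (by positivity))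
      (by positivity)
  have e2 : ρ ^ 2 * exp (-K ^ 10) * sl * exp (-(su / 2)) * (2 * w) * exp (K ^ 10)
      = ρ ^ 2 * sl * exp (-(su / 2)) * (2 * w) * (exp (-K ^ 10) * exp (K ^ 10)) := by ring
  rw [e2, hee, mul_one] at hlow
  linarith only [hnum2, h1, hlow, hc u huI]

end Summit.NavierStokesRegularity.FluidComputer.GateBudget
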